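import Literature.Topology.FourManifolds.BordismProofs
import Literature.Topology.FourManifolds.BordismReflProofs
import Literature.Topology.FourManifolds.BordismSumCommProofs
import Literature.Topology.FourManifolds.CobordismAttachmentProofs
import Literature.Topology.FourManifolds.BordismFourNullBordism
import HarnessLib

/-!
# Singular bordism is transitive in positive dimension; `𝔑ₙ₊₁(Y)` is a group unconditionally
(proofs for `Bordism.lean`)

Topic `Literature/Topology/FourManifolds`, sibling proof file of `Bordism.lean` (named fact
`Literature.Topology.FourManifolds.ClosedSingularManifold.IsBordant.trans`: bordism of closed
singular `n`-manifolds on a space is transitive; Milnor–Stasheff, *Characteristic classes*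
(1974), §17, Lemma 17.1; Conner–Floyd, *Differentiable periodic maps* (1964), Ch. I §4;
geometrically Milnor, *Lectures on the h-cobordism theorem* (1965), Thm. 1.4 — glue the two
cobordisms along the common end and extend the maps).  Written from the fact seat of
`isOrientedBordant_of_isEmpty_of_signature_eq_zero` (Kirby 1989, Cor. IX.2), whose statement
`spc4.S36` (`BordismFour.lean`) has the unoriented half `𝔑₄ ≅ (ℤ/2)²`
(`natCard_unorientedBordismClass_four`) phrased through `BordismClass`, meaningful only once
`BordismFacts _ 4` is inhabited.

* §1 `CobordismAttachment.exists_continuousMap_paste` — **pasting lemma over an attachment**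
  `V = W ∪_ψ X` (`CobordismAttachment.lean`): continuous `FW : W → Y`, `FX : X → Y` agreeing
  along the seam `∂W ≡_ψ M` paste to a continuous `F : V → Y` (`W` compact, `V` Hausdorff:
  preimages of closed sets are unions of two continuous images of compact sets).
* §2 `ClosedSingularManifold.IsBordant.trans_succ : IsBordant.trans (n := n + 1)` — **the named
  fact in every positive dimension**: given `(W₁, F₁) : (M, f) ∼ (N, g)` and
  `(W₂, F₂) : (N, g) ∼ (P, h)`, read `W₁` as a manifold with boundary datum `∂W₁ = M ⊔ N`
  (`IsSmoothEmbedding.sumElim`), attach the cobordism `(M × [0,1]) ⊔ W₂` from `M ⊔ N` to `M ⊔ P`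
  (`exists_cobordismAttachment_holds`, `Cobordism.exists_sum`, `cylinderCobordism`) along the
  identity; the result `V` has `∂V = M ⊔ P` (a cobordism from `M` to `P` by
  `isSmoothEmbedding_comp_inl/inr`) and carries the pasted map `F₁ ∪ ((f ∘ pr₁) ⊔ F₂)`.
  Dimension `0` is NOT covered: the fact is stated for every `n`, but the tree's attachment
  structure cannot exist in total dimension `1` (`exists_cobordismAttachment`), so this is not
  an exact discharge of `IsBordant.trans`.
* §3 `ClosedSingularManifold.bordismFacts_succ : BordismFacts Y (n + 1)` — with the tree's
  discharges `isBordant_refl_holds` (`BordismReflProofs.lean`), `IsBordant.sum_holds`,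
  `isBordant_sum_self_empty_holds` (`BordismProofs.lean`), `isBordant_sum_comm/assoc/empty_holds`
  (`BordismSumCommProofs.lean`) and §2, **all bordism facts hold in positive dimension**, so
  `BordismClass Y (n + 1)` — in particular `UnorientedBordismClass 4` — is an elementary
  abelian `2`-group with no hypotheses (stated as a theorem, to be used via
  `haveI := bordismFacts_succ`; e.g. `BordismClass.mk_eq_mk_iff_succ`).

Everything here is proved; no definitions, no named facts, no instances.

## References

* J. Milnor, J. Stasheff, *Characteristic classes*, Ann. of Math. Studies 76 (1974), §17,
  Lemma 17.1. [MilnorStasheffAMS76]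
* J. Milnor, *Lectures on the h-cobordism theorem*, Princeton 1965, §1, Thm. 1.4. [Milnor1965]
* P. E. Conner, E. E. Floyd, *Differentiable periodic maps* (1964), Ch. I §4.
-/

noncomputable section

open scoped Manifold ContDiff Topology
open Set Function _root_.Topology

universe u

namespace Literature.Topology.FourManifolds

/-! ### §1 Pasting continuous maps over an attachment `V = W ∪_ψ X` -/

namespace CobordismAttachment

variable {n : ℕ} {W : Type u} [TopologicalSpace W] [ChartedSpace (EuclideanHalfSpace (n + 1)) W]
  {M N : Type u} [TopologicalSpace M] [ChartedSpace (EuclideanSpace ℝ (Fin n)) M]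
  [TopologicalSpace N] [ChartedSpace (EuclideanSpace ℝ (Fin n)) N]
  {b : BoundaryData (𝓡∂ (n + 1)) W (𝓡 n)} {X : Cobordism n M N}
  {ψ : b.carrier ≃ₘ⟮𝓡 n, 𝓡 n⟯ M} {V : Type u} [TopologicalSpace V]
  [ChartedSpace (EuclideanHalfSpace (n + 1)) V]
  {Y : Type*} [TopologicalSpace Y]

/-- **Pasting lemma over an attachment.**  Continuous maps `FW : W → Y`, `FX : X → Y` which agree
along the seam `∂W ≡_ψ M` paste to a continuous map on `V = W ∪_ψ X` restricting to `FW` on the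
image of `W` and to `FX` on the image of `X` (`W` compact, `V` Hausdorff: on the image of `W`
use `FW`, elsewhere `FX`; the preimage of a closed set is the union of two continuous images of
compact sets, hence closed). [folklore] -/
theorem exists_continuousMap_paste [CompactSpace W] [T2Space V] (A : CobordismAttachment b X ψ V)
    (FW : C(W, Y)) (FX : C(X.W, Y)) (hseam : ∀ z, FW (b.incl z) = FX (X.inl (ψ z))) :
    ∃ F : C(V, Y), (∀ w, F (A.jW w) = FW w) ∧ ∀ x, F (A.jX x) = FX x := by
  classical
  -- the set-theoretic pasting
  let F : V → Y := fun v =>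
    if h : ∃ w, A.jW w = v then FW h.choose else FX ((A.exists_jW_eq_or v).resolve_left h).choose
  have hFW : ∀ w, F (A.jW w) = FW w := fun w => by
    have h : ∃ w', A.jW w' = A.jW w := ⟨w, rfl⟩
    simp only [F, dif_pos h]
    exact congrArg FW (A.injective_jW h.choose_spec)
  have hFX : ∀ x, F (A.jX x) = FX x := fun x => by
    by_cases h : ∃ w, A.jW w = A.jX x
    · simp only [F, dif_pos h]
      obtain ⟨z, hz, hx⟩ := (A.jW_eq_jX_iff _ _).1 h.choose_spec
      rw [hz, hseam, ← hx]
    · simp only [F, dif_neg h]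
      exact congrArg FX (A.injective_jX ((A.exists_jW_eq_or (A.jX x)).resolve_left h).choose_spec)
  -- preimages: `F⁻¹(s) = jW(FW⁻¹ s) ∪ jX(FX⁻¹ s)`
  have hpre : ∀ s : Set Y, F ⁻¹' s = A.jW '' (FW ⁻¹' s) ∪ A.jX '' (FX ⁻¹' s) := fun s => by
    ext v
    constructor
    · intro hv
      rcases A.exists_jW_eq_or v with ⟨w, rfl⟩ | ⟨x, rfl⟩
      · exact Or.inl ⟨w, by simpa only [mem_preimage, hFW] using hv, rfl⟩
      · exact Or.inr ⟨x, by simpa only [mem_preimage, hFX] using hv, rfl⟩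
    · rintro (⟨w, hw, rfl⟩ | ⟨x, hx, rfl⟩)
      · simpa only [mem_preimage, hFW] using hw
      · simpa only [mem_preimage, hFX] using hx
  have hF : Continuous F := by
    rw [continuous_iff_isClosed]
    intro s hs
    rw [hpre]
    exact (((hs.preimage FW.continuous).isCompact.image A.continuous_jW).isClosed).union
      (((hs.preimage FX.continuous).isCompact.image A.continuous_jX).isClosed)
  exact ⟨⟨F, hF⟩, hFW, hFX⟩

end CobordismAttachment

/-! ### §2 Singular bordism is transitive in positive dimension -/

namespace ClosedSingularManifold

variable {Y : Type*} [TopologicalSpace Y] {n : ℕ}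

/-- **Bordism of closed singular manifolds is transitive in positive dimension** — the tree's
named fact `ClosedSingularManifold.IsBordant.trans` (`Bordism.lean`; Milnor–Stasheff 1974,
Lemma 17.1; Conner–Floyd 1964, Ch. I §4) at dimension `n + 1`.  Given bordisms `(W₁, F₁)` from
`(M, f)` to `(N, g)` and `(W₂, F₂)` from `(N, g)` to `(P, h)`: read `W₁` as a manifold with
boundary datum `∂W₁ = M ⊔ N`, attach the cobordism `(M × [0,1]) ⊔ W₂` from `M ⊔ N` to `M ⊔ P`
(`exists_cobordismAttachment_holds`, Milnor 1965 Thm. 1.4; `Cobordism.exists_sum`,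
`cylinderCobordism`); the result `V` has `∂V = M ⊔ P`, so it is a cobordism from `M` to `P`, and
the maps `F₁` and `(f ∘ pr₁) ⊔ F₂` agree along the seam (`F₁ ∘ inl = f`, `F₁ ∘ inr = g = F₂ ∘ inl`)
and paste to `F : V → Y` (`CobordismAttachment.exists_continuousMap_paste`).  Dimension `0` is not covered (the
attachment structure does not exist in total dimension `1`). [cite: MilnorStasheffAMS76, Lemma 17.1] -/
theorem IsBordant.trans_succ : IsBordant.trans.{u} (X := Y) (n := n + 1) := by
  intro s t r h₁ h₂
  obtain ⟨c₁, F₁, hl₁, hr₁⟩ := h₁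
  obtain ⟨c₂, F₂, hl₂, hr₂⟩ := h₂
  haveI : SecondCountableTopology s.M :=
    ChartedSpace.secondCountable_of_sigmaCompact (EuclideanSpace ℝ (Fin (n + 1))) s.M
  -- `∂W₁ = M ⊔ N` as a boundary datum
  let b : BoundaryData (𝓡∂ (n + 2)) c₁.W (𝓡 (n + 1)) :=
    { carrier := s.M ⊕ t.M
      incl := Sum.elim c₁.inl c₁.inr
      isSmoothEmbedding := c₁.isSmoothEmbedding_inl.sumElim c₁.isSmoothEmbedding_inr
        c₁.disjoint_range
      range_incl := by rw [Set.Sum.elim_range, c₁.range_inl_union_range_inr] }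
  -- the cobordism `(M × [0, 1]) ⊔ W₂` from `M ⊔ N` to `M ⊔ P`, with the map `(f ∘ pr₁) ⊔ F₂`
  obtain ⟨d, Φ, hΦl, hΦr⟩ := (cylinderCobordism (n + 1) s.M).exists_sum c₂
  let Fd : C(d.W, Y) :=
    (⟨Sum.elim ((⟨s.f, s.hf⟩ : C(s.M, Y)).comp Cylinder.proj) F₂,
      (((⟨s.f, s.hf⟩ : C(s.M, Y)).comp Cylinder.proj).continuous.sumElim F₂.continuous)⟩ :
        C((cylinderCobordism (n + 1) s.M).W ⊕ c₂.W, Y)).comp ⟨Φ, Φ.continuous⟩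
  -- attach it to `W₁` along the identity of `M ⊔ N`
  obtain ⟨V, _, _, _, _, _, ⟨A⟩⟩ := exists_cobordismAttachment_holds n c₁.W b (s.M ⊕ t.M)
    (s.M ⊕ r.M) d (Diffeomorph.refl (𝓡 (n + 1)) (s.M ⊕ t.M) ∞)
  haveI : CompactSpace V := A.compactSpace
  have hseam : ∀ z, F₁ (b.incl z) = Fd (d.inl ((Diffeomorph.refl (𝓡 (n + 1)) (s.M ⊕ t.M) ∞) z)) := by
    rintro (m | y)
    · change F₁ (c₁.inl m) = Sum.elim _ F₂ (Φ (d.inl (Sum.inl m)))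
      rw [hΦl, hl₁]
      rfl
    · change F₁ (c₁.inr y) = Sum.elim _ F₂ (Φ (d.inl (Sum.inr y)))
      rw [hΦl, hr₁]
      exact (hl₂ y).symm
  obtain ⟨F, hFW, hFX⟩ := A.exists_continuousMap_paste F₁ Fd hseam
  refine ⟨{ W := V
            inl := (A.jX ∘ d.inr) ∘ Sum.inl
            inr := (A.jX ∘ d.inr) ∘ Sum.inr
            isSmoothEmbedding_inl := isSmoothEmbedding_comp_inl A.isSmoothEmbedding_jX_comp_inr
            isSmoothEmbedding_inr := isSmoothEmbedding_comp_inr A.isSmoothEmbedding_jX_comp_inr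
            disjoint_range := Set.disjoint_left.2 (by
              rintro _ ⟨x, rfl⟩ ⟨y, hy⟩
              exact Sum.inr_ne_inl (A.isSmoothEmbedding_jX_comp_inr.isEmbedding.injective hy))
            range_inl_union_range_inr := by
              rw [← A.range_jX_comp_inr]
              ext v
              constructor
              · rintro (⟨x, rfl⟩ | ⟨y, rfl⟩)
                · exact ⟨Sum.inl x, rfl⟩
                · exact ⟨Sum.inr y, rfl⟩
              · rintro ⟨x | y, rfl⟩
                · exact Or.inl ⟨x, rfl⟩
                · exact Or.inr ⟨y, rfl⟩ },
    F, fun m => ?_, fun p => ?_⟩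
  · change F (A.jX (d.inr (Sum.inl m))) = s.f m
    rw [hFX]
    change Sum.elim _ F₂ (Φ (d.inr (Sum.inl m))) = s.f m
    rw [hΦr]
    rfl
  · change F (A.jX (d.inr (Sum.inr p))) = r.f p
    rw [hFX]
    change Sum.elim _ F₂ (Φ (d.inr (Sum.inr p))) = r.f p
    rw [hΦr]
    exact hr₂ p

/-- **The bordism facts hold in positive dimension**: with reflexivity (`isBordant_refl_holds`),
transitivity (`IsBordant.trans_succ`), disjoint unions (`IsBordant.sum_holds`), `2[M, f] = 0`
(`isBordant_sum_self_empty_holds`) and the commutativity, associativity and unit laws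
(`BordismSumCommProofs.lean`) all proved, the class `BordismFacts Y (n + 1)` is inhabited: the
bordism classes `BordismClass Y (n + 1)` (`𝔑ₙ₊₁(Y)`) form an elementary abelian `2`-group
unconditionally (Milnor–Stasheff 1974, §17; Conner–Floyd 1964, Ch. I §4).
[cite: MilnorStasheffAMS76, Lemma 17.1] -/
theorem bordismFacts_succ : BordismFacts.{u} Y (n + 1) where
  refl := isBordant_refl_holds
  trans := IsBordant.trans_succ
  sum := IsBordant.sum_holds
  sum_self_empty := isBordant_sum_self_empty_holds
  sum_comm := isBordant_sum_comm_holds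
  sum_assoc := isBordant_sum_assoc_holds
  sum_empty := isBordant_sum_empty_holds

/-- **`𝔑ₙ₊₁(Y)` is a group unconditionally**: e.g. two closed singular `(n+1)`-manifolds have the
same bordism class iff they are bordant (`BordismClass.mk_eq_mk_iff` with the facts supplied by
`bordismFacts_succ`; Milnor–Stasheff 1974, Lemma 17.1). [cite: MilnorStasheffAMS76, Lemma 17.1] -/
theorem _root_.Literature.Topology.FourManifolds.BordismClass.mk_eq_mk_iff_succ
    (s t : ClosedSingularManifold.{u} Y (n + 1)) :
    BordismClass.mk s = BordismClass.mk t ↔ s.IsBordant t :=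
  haveI := bordismFacts_succ (Y := Y) (n := n)
  BordismClass.mk_eq_mk_iff

end ClosedSingularManifold

end Literature.Topology.FourManifolds

end
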